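import Mathlib
import Literature.Computability.Complexity.CircuitClasses
import Literature.Computability.Complexity.Classes
import Literature.Computability.Complexity.ConstantDepth
import Literature.Computability.Complexity.CircuitRestriction
import Literature.Computability.Complexity.Promise
import Literature.Computability.MetaComplexity.FormulaModelsAE
import Literature.Computability.MetaComplexity.LevinKt
import Literature.Computability.MetaComplexity.XorBottomModelsAE
import Literature.Computability.MetaComplexity.OliveiraPichSanthanam2019.GapMKtPMagnification
import HarnessLib

/-!
# CHOPRS, HM Frontier A (`MKtP[n^c, 2n^c]` versus `AC⁰-XOR`): Theorem 14 (the magnification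
# threshold, T), item A1 derived from it, Theorem 15 and item A4 (the known `AC⁰` lower bound, K) —
# as named facts (census row R22, a MODEL-MISMATCH row)

Source: L. Chen, S. Hirahara, I. C. Oliveira, J. Pich, N. Rajgopal, R. Santhanam, *Beyond natural
proofs: hardness magnification and locality*, arXiv:1911.08297 (ITCS 2020 / J. ACM 69(4) 2022) (bib
key `arXiv191108297`), §1.1 "HM Frontier A" (p. 3), §3.1 Theorems 14 and 15 (pp. 12–14), §5.1.1
Proposition 39 (the locality barrier A1^𝒪/A3^𝒪, p. 23).

## The printed statements (verbatim; in the LaTeX source `\NC` is the macro for `NC¹` and `\AC` for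
## `AC⁰` — A1 below and Theorem 14 are the same statement spelled both ways)

* §1.1 (p. 3): *"A1. If MKtP[n^c, 2n^c] ∉ AC⁰-XOR[N^{1.01}] for large c > 1 then EXP ⊄ NC¹."*
  *"A3. Majority ∉ AC⁰-XOR[2^{N^{o(1)}}] (immediate from [Razborov87, Smolensky87])."*
  *"A4. MKtP[n^c, 2n^c] ∉ AC⁰ for any sufficiently large constant c."*
  *"A. MKtP[s, t] refers to the promise problem of determining if an N-bit input has Levin Kolmogorov
  complexity at most s versus at least t (cf. [OPS19]). Here N = 2^n. The AC⁰-XOR model is the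
  extension of AC⁰ where gates at the bottom layer of the circuit can compute arbitrary parity
  functions. AC⁰-XOR[s] denotes AC⁰-XOR circuits of size s where the size is measured as the number
  of gates."*
* §3.1 (p. 12): *"For thresholds θ, θ' : ℕ → ℕ, we denote by MKtP[θ(N), θ'(N)] the promise problem
  whose YES instances consist of the strings x ∈ {0,1}^N such that Kt(x) ≤ θ(N) and NO instances
  consist of the strings such that Kt(x) > θ'(N)."*
* **Theorem 14.** *"There exists a constant c such that, for every large enough constant d > 1,
  MKtP[(log N)^d, (log N)^d + c log N] ∉ AC⁰-XOR[N^{1.01}] implies EXP ⊄ NC¹."* (Proof, p. 12: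
  contrapositive; under `EXP ⊆ NC¹` the `AND_{O(N)} ∘ L_{O(θ(N))} ∘ XOR` oracle circuits of [OPS19]
  for `MKtP[θ(N), θ(N) + c log N]` become depth-`(d' + O(1))` almost-linear-size AC⁰ circuits with
  bottom XOR gates.)
* **Theorem 15.** *"For any d = d(N), for some θ(N) = d · Õ(log N)³ and any θ'(N) = N/ω(log N)^d,
  it holds that MKtP[θ(N), θ'(N)] ∉ AC⁰_d."* (Proof, pp. 12–14: Trevisan–Xue pseudorandom
  restrictions of seed length `d × polylog(N)`, so `Kt(0^N ∘ ρ) ≤ polylog(N)`; a depth-`d` size-`N^{O(1)}`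
  circuit becomes a shallow decision tree, forced constant by Lemma 20, and counting accepted inputs
  at ONE large length `N` gives `2^{N/O(log N)^d} ≤ 2^{θ'(N)+1}`, a contradiction. The argument refutes
  every polynomial-size depth-`d` circuit at every sufficiently large length.)

## Census value (row R22)

T and K are about the SAME promise problem `MKtP[n^c, 2n^c]` at the same input length `N = 2^n`, but
in DIFFERENT models: the threshold A1/Thm 14 is against `AC⁰-XOR[N^{1.01}]` (constant depth, almost
linear size, a bottom layer of parities), the known bound A4/Thm 15 against `AC⁰` = `AC⁰_d[poly]` for
every constant `d` (no parities). `AC⁰ ⊊ AC⁰-XOR` as circuit classes at polynomial size (parity itself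
separates them), so NO NUMERIC GAP is stated: the row is MODEL-MISMATCH. In the threshold model
nothing is known for `MKtP`: Hirahara (ToC 19(4) 2023, pp. 11–12) records `MKtP[c log N, N^α] ∉
i.o.-AC⁰_d(N^k)` and remarks that *extending it to AC⁰_d ∘ XOR would suffice for a breakthrough*. The
locality barrier covering the row is CHOPRS Prop. 39: (A1^𝒪) *"MKtP[n^c, 2n^c] ∈ AND-𝒪-XOR[N^{1.01}]
… the output gate is an AND gate of fan-in O(N), at the middle layer are oracle gates of fan-in
poly(n), and at the bottom layer are XOR gates"*, (A3^𝒪) the Razborov–Smolensky method localizes.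
(The tree's `Literature.Barriers.PneNP.Locality` formalises Frontier E only.)

## Rendering (each choice makes a THRESHOLD fact's hypothesis imply the printed hypothesis — our
## class ⊇ print's, our promise problem ⊆ print's — and a KNOWN fact weaker than the printed one)

* `Kt`, `MKtP[θ, θ']` ↦ `U.levinKt`, `U.gapMKtP θ θ'` of `LevinKt.lean` (integer `Kt` with `⌈log t⌉`,
  OPS Def. 2.1, the reference CHOPRS point to; `∀ U : UniversalMachine` in front of every fact, the
  constants depending on `U`). Real thresholds are rendered EXACTLY by `⌊·⌋₊` (`Kt ≤ r ↔ Kt ≤ ⌊r⌋₊`,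
  `Kt > r ↔ Kt > ⌊r⌋₊`): `frontierAYes d N = ⌊(log₂ N)^d⌋₊`, `frontierANo d c N = ⌊(log₂ N)^d +
  c log₂ N⌋₊`, `frontierA1No d N = ⌊2 (log₂ N)^d⌋₊` (`n = log₂ N` real; `N` the input length).
* "constant d > 1", "large c > 1" ↦ natural numbers beyond a bound (`∃ d₀, ∀ d ≥ d₀`): a
  specialisation of the printed real constants, so each typed fact is implied by the printed one.
* `AC⁰-XOR[N^{1.01}]` ↦ `ACdXORae e (powSize 1.01)` for EVERY depth `e` (`XorBottomModelsAE`: a.e.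
  size bound `⌊N^{1.01}⌋₊` on non-negation gates, parities reading inputs only; the module docstring
  there shows the printed class is contained in ours at every fixed depth), and "`∉ AC⁰-XOR[s]`"
  (constant, unspecified depth) ↦ `∀ e, ∉ promiseLift (ACdXORae e s)`.
* `EXP ⊄ NC¹` ↦ `¬ (EXP ⊆ NC1)` with the tree's non-uniform `NC1` (⊆ the textbook non-uniform `NC¹`;
  the proof of Thm 14 only uses non-uniform `NC¹` circuits for `EXP`), as in `ChenJinWilliams2020`.
* `AC⁰_d` (K side) ↦ the tree's `ACd d` (every length, polynomial size, `acBasis`, `acDepth ≤ d`;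
  contained in the printed non-uniform `AC⁰_d`: negations inside the circuit are pushed to the inputs
  at polynomial cost without changing `acDepth`), for CONSTANT `d ≥ 1` only (print allows `d = d(N)`);
  `θ = d·Õ(log N)³` ↦ `∃ θ, ∃ C, ∀ᶠ N, θ N ≤ d (log₂ N)³ (log₂ log₂ N)^C`; `θ' = N/ω(log N)^d` ↦ every
  `θ' : ℕ → ℕ` with `θ'(N) (log₂ N)^d / N → 0` (equivalent for constant `d`); "`∉ AC⁰_d`" ↦ no
  language of `ACd d` separates ANY TAIL of the promise problem (the printed proof is pointwise at
  every large length, see above), which is what makes A4 a formal consequence (not derived here: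
  it needs `θ_d(N) ≤ (log₂ N)^c` and `(log₂ N)^{c+d} = o(N)`, routine but long real asymptotics).
* `AC⁰` (A4) ↦ the tree's `AC0` (`= ⋃_d ACd d`, `AC0_eq_iUnion_ACd`).
* NON-VACUITY (F1 of the census protocol): `headLang ∈ ACd d` for `d ≥ 1` and `headLang ∈ ACdXORae
  e s` (`XorBottomModelsAE`), so neither the K facts nor the T hypotheses are about an empty class;
  the NO sides are non-empty at all large lengths by `UniversalMachine.exists_mem_gapMKtP_no`.
* HONEST FRAMING: `chop_thm14`/`chop_frontierA1` are THRESHOLD facts, `chop_thm15`/`chop_frontierA4`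
  KNOWN bounds in a weaker model; `FrontierA1Hypothesis` is the OPEN statement; nothing here is an
  approach to the summit.
-/

noncomputable section

namespace Literature.Computability.MetaComplexity

open Filter Topology
open Literature.Computability.Complexity Literature.Computability.MetaComplexity.OliveiraPichSanthanam2019

/-! ### Thresholds -/

/-- YES threshold `⌊(log₂ N)^d⌋₊` of `MKtP[(log N)^d, ·]` = `MKtP[n^d, ·]` (`n = log₂ N`).
[cite: arXiv191108297, Thm. 14 (thresholds)] -/
def frontierAYes (d : ℕ) (N : ℕ) : ℕ := ⌊Real.logb 2 N ^ d⌋₊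

/-- NO threshold `⌊(log₂ N)^d + c log₂ N⌋₊` of Theorem 14. [cite: arXiv191108297, Thm. 14 (thresholds)] -/
def frontierANo (d c : ℕ) (N : ℕ) : ℕ := ⌊Real.logb 2 N ^ d + c * Real.logb 2 N⌋₊

/-- NO threshold `⌊2 (log₂ N)^c⌋₊` of items A1/A4 (`MKtP[n^c, 2n^c]`). [cite: arXiv191108297, §1.1 (A1, thresholds)] -/
def frontierA1No (c : ℕ) (N : ℕ) : ℕ := ⌊2 * Real.logb 2 N ^ c⌋₊

/-- `0 ≤ log₂ N` for every natural `N` (`log₂ 0 = 0`). [folklore] -/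
theorem logb_two_natCast_nonneg (N : ℕ) : 0 ≤ Real.logb 2 (N : ℝ) := by
  rcases Nat.eq_zero_or_pos N with rfl | hN
  · simp
  · exact Real.logb_nonneg one_lt_two (by exact_mod_cast hN)

/-- `⌊(log₂ N)^c⌋ ≤ ⌊2 (log₂ N)^c⌋`: the promise problem of A1/A4 is disjoint. [folklore] -/
theorem frontierAYes_le_frontierA1No (c N : ℕ) : frontierAYes c N ≤ frontierA1No c N := by
  unfold frontierAYes frontierA1No
  apply Nat.floor_le_floor
  have := pow_nonneg (logb_two_natCast_nonneg N) c
  linarith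

/-- `⌊(log₂ N)^d⌋ ≤ ⌊(log₂ N)^d + c log₂ N⌋`: the promise problem of Theorem 14 is disjoint. [folklore] -/
theorem frontierAYes_le_frontierANo (d c N : ℕ) : frontierAYes d N ≤ frontierANo d c N := by
  unfold frontierAYes frontierANo
  apply Nat.floor_le_floor
  have := mul_nonneg (Nat.cast_nonneg c) (logb_two_natCast_nonneg N)
  linarith

/-- For `d ≥ 2` and `N ≥ 2^{max c 1}`: `(log₂ N)^d + c log₂ N ≤ 2 (log₂ N)^d`, hence
`frontierANo d c N ≤ frontierA1No d N` — from some length on, the NO instances of `MKtP[n^d, 2n^d]`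
are NO instances of `MKtP[(log N)^d, (log N)^d + c log N]`. [folklore] -/
theorem frontierANo_le_frontierA1No {d : ℕ} (hd : 2 ≤ d) (c : ℕ) :
    ∃ N₀ : ℕ, ∀ N : ℕ, N₀ ≤ N → frontierANo d c N ≤ frontierA1No d N := by
  refine ⟨2 ^ max c 1, fun N hN => ?_⟩
  unfold frontierANo frontierA1No
  apply Nat.floor_le_floor
  set L := Real.logb 2 (N : ℝ) with hL
  have hpos : (0 : ℝ) < (2 : ℝ) ^ (max c 1) := by positivity
  have hNL : ((max c 1 : ℕ) : ℝ) ≤ L := by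
    have h2N : (2 : ℝ) ^ (max c 1) ≤ (N : ℝ) := by exact_mod_cast hN
    have h1 := Real.logb_le_logb_of_le (b := 2) one_lt_two hpos h2N
    have h2 : Real.logb 2 ((2 : ℝ) ^ (max c 1)) = (max c 1 : ℕ) := by
      rw [Real.logb_pow, Real.logb_self_eq_one one_lt_two, mul_one]
    rw [h2] at h1
    exact h1
  have hc : (c : ℝ) ≤ L := le_trans (by exact_mod_cast le_max_left c 1) hNL
  have h1 : (1 : ℝ) ≤ L := le_trans (by exact_mod_cast le_max_right c 1) hNL
  have hL0 : 0 ≤ L := zero_le_one.trans h1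
  have hcL : (c : ℝ) * L ≤ L ^ d :=
    calc (c : ℝ) * L ≤ L * L := mul_le_mul_of_nonneg_right hc hL0
      _ = L ^ 2 := by ring
      _ ≤ L ^ d := pow_le_pow_right₀ h1 hd
  linarith

/-! ### Statements -/

/-- **`MKtP[(log N)^d, (log N)^d + c log N] ∉ AC⁰-XOR[N^{1.01}]`** for the machine `U` (the hypothesis
of Theorem 14 at `d`, `c`): for every constant depth `e`, no language of `ACdXORae e ⌊N^{1.01}⌋`
separates YES from NO. OPEN at the relevant `d`, `c`; recorded, not asserted.
[cite: arXiv191108297, Thm. 14 (hypothesis)] -/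
def MKtPACXorLB (U : UniversalMachine) (d c : ℕ) : Prop :=
  ∀ e : ℕ, U.gapMKtP (frontierAYes d) (frontierANo d c) ∉ promiseLift (ACdXORae e (powSize 1.01))

/-- **The hypothesis of A1 at `c`** (census gap R22, T side): *"MKtP[n^c, 2n^c] ∉ AC⁰-XOR[N^{1.01}]"*,
every constant depth. OPEN; recorded, not asserted. [cite: arXiv191108297, §1.1 (A1, hypothesis)] -/
def FrontierA1Hypothesis (U : UniversalMachine) (c : ℕ) : Prop :=
  ∀ e : ℕ, U.gapMKtP (frontierAYes c) (frontierA1No c) ∉ promiseLift (ACdXORae e (powSize 1.01))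

/-- NAMED FACT (**CHOPRS Theorem 14**, hardness magnification for `MKtP` against `AC⁰-XOR`):
*"There exists a constant c such that, for every large enough constant d > 1,
MKtP[(log N)^d, (log N)^d + c log N] ∉ AC⁰-XOR[N^{1.01}] implies EXP ⊄ NC¹."* Users take
`(h : chop_thm14)`. [cite: arXiv191108297, Thm. 14] -/
def chop_thm14 : Prop :=
  ∀ U : UniversalMachine, ∃ c : ℕ, ∃ d₀ : ℕ, ∀ d : ℕ, d₀ ≤ d → MKtPACXorLB U d c → ¬ (EXP ⊆ NC1)

/-- NAMED FACT (**CHOPRS §1.1, HM Frontier A, item A1**; proof: Theorem 14): *"If MKtP[n^c, 2n^c] ∉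
AC⁰-XOR[N^{1.01}] for large c > 1 then EXP ⊄ NC¹."* — for every sufficiently large constant `c`, the
lower bound at `c` implies the separation. A formal consequence of `chop_thm14`
(`chop_frontierA1_of_thm14`). Users take `(h : chop_frontierA1)`. [cite: arXiv191108297, §1.1 (A1)] -/
def chop_frontierA1 : Prop :=
  ∀ U : UniversalMachine, ∃ c₀ : ℕ, ∀ c : ℕ, c₀ ≤ c → FrontierA1Hypothesis U c → ¬ (EXP ⊆ NC1)

/-- NAMED FACT (**CHOPRS Theorem 15**, a PROVED theorem, vendored; constant depth `d ≥ 1`): *"For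
any d = d(N), for some θ(N) = d · Õ(log N)³ and any θ'(N) = N/ω(log N)^d, it holds that MKtP[θ(N),
θ'(N)] ∉ AC⁰_d."* Rendering (module docstring): `θ N ≤ d (log₂ N)³ (log₂ log₂ N)^C` eventually for
some `C`; every `θ'` with `θ'(N)(log₂ N)^d/N → 0`; no language of the tree's `ACd d` separates any
tail of the promise problem. Users take `(h : chop_thm15)`. [cite: arXiv191108297, Thm. 15] -/
def chop_thm15 : Prop :=
  ∀ U : UniversalMachine, ∀ d : ℕ, 1 ≤ d →
    ∃ θ : ℕ → ℕ, (∃ C : ℕ, ∀ᶠ N : ℕ in atTop,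
        (θ N : ℝ) ≤ d * Real.logb 2 N ^ 3 * Real.logb 2 (Real.logb 2 N) ^ C) ∧
      ∀ θ' : ℕ → ℕ, Tendsto (fun N : ℕ => (θ' N : ℝ) * Real.logb 2 N ^ d / N) atTop (𝓝 0) →
        ∀ N₀ : ℕ, (U.gapMKtP θ θ').tailFrom N₀ ∉ promiseLift (ACd d)

/-- NAMED FACT (**CHOPRS §1.1, HM Frontier A, item A4**; proof: Theorem 15 — census row R22, K
side, in the WEAKER model `AC⁰`): *"MKtP[n^c, 2n^c] ∉ AC⁰ for any sufficiently large constant c."*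
Users take `(h : chop_frontierA4)`. [cite: arXiv191108297, §1.1 (A4)] -/
def chop_frontierA4 : Prop :=
  ∀ U : UniversalMachine, ∃ c₀ : ℕ, ∀ c : ℕ, c₀ ≤ c →
    U.gapMKtP (frontierAYes c) (frontierA1No c) ∉ promiseLift AC0

/-! ### API: consequence shapes and A1 from Theorem 14 -/

/-- Consequence shape of Theorem 14. [cite: arXiv191108297, Thm. 14] -/
theorem not_EXP_subset_NC1_of_mktpACXorLB (h : chop_thm14) (U : UniversalMachine)
    (hU : ∀ d c : ℕ, MKtPACXorLB U d c) : ¬ (EXP ⊆ NC1) := by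
  obtain ⟨c, d₀, hd₀⟩ := h U
  exact hd₀ d₀ le_rfl (hU d₀ c)

/-- The promise problem of A1/A4 is disjoint. [folklore] -/
theorem gapMKtP_frontierA1_disjoint (U : UniversalMachine) (c : ℕ) :
    (U.gapMKtP (frontierAYes c) (frontierA1No c)).Disjoint :=
  U.gapMKtP_disjoint (frontierAYes_le_frontierA1No c)

/-- **A1's hypothesis implies Theorem 14's** for `d = c ≥ 2` and any gap constant: a separator of
`MKtP[(log N)^c, (log N)^c + c' log N]` separates the tail of `MKtP[n^c, 2n^c]` from the length where
`c' log N ≤ (log N)^c` on, and over an almost-everywhere class a disjoint promise problem is separated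
iff some tail is (`not_mem_promiseLift_iff_forall_tailFrom`). [folklore] -/
theorem mktpACXorLB_of_frontierA1Hypothesis (U : UniversalMachine) {c : ℕ} (hc : 2 ≤ c) (c' : ℕ)
    (hA : FrontierA1Hypothesis U c) : MKtPACXorLB U c c' := by
  intro e hQ
  obtain ⟨N₀, hN₀⟩ := frontierANo_le_frontierA1No hc c'
  have htail : (U.gapMKtP (frontierAYes c) (frontierA1No c)).tailFrom N₀ ∈
      promiseLift (ACdXORae e (powSize 1.01)) :=
    tailFrom_mem_promiseLift_of_imp (R := U.gapMKtP (frontierAYes c) (frontierANo c c'))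
      (fun _ _ hx => hx) (fun x hx hxno => by
      rw [UniversalMachine.mem_gapMKtP_no_iff] at hxno ⊢
      exact lt_of_le_of_lt (by exact_mod_cast hN₀ x.length hx) hxno) hQ
  exact (not_mem_promiseLift_iff_forall_tailFrom (gapMKtP_frontierA1_disjoint U c)).1 (hA e) N₀ htail

/-- **A1 follows from Theorem 14** (with `c₀ = max d₀ 2` for the `d₀` of Theorem 14). [folklore] -/
theorem chop_frontierA1_of_thm14 (h : chop_thm14) : chop_frontierA1 := by
  intro U
  obtain ⟨c', d₀, hd₀⟩ := h U
  exact ⟨max d₀ 2, fun c hc hA =>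
    hd₀ c (le_of_max_le_left hc) (mktpACXorLB_of_frontierA1Hypothesis U (le_of_max_le_right hc) c' hA)⟩

/-- Consequence shape of A1. [cite: arXiv191108297, §1.1 (A1)] -/
theorem not_EXP_subset_NC1_of_frontierA1Hypothesis (h : chop_frontierA1) (U : UniversalMachine)
    (hU : ∀ c : ℕ, FrontierA1Hypothesis U c) : ¬ (EXP ⊆ NC1) := by
  obtain ⟨c₀, hc₀⟩ := h U
  exact hc₀ c₀ le_rfl (hU c₀)

/-! ### API: non-vacuity -/

/-- **`ACd d` is inhabited for `d ≥ 1`**: `headLang` (first bit `1`) is decided by the family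
"constant `0` at length `0`, the projection `x₀` otherwise" — over `acBasis`, depth `≤ 1`, at most one
gate. (At depth `0` the class is empty: on zero inputs every circuit has a gate of positive weight.)
[folklore] -/
theorem headLang_mem_ACd {d : ℕ} (hd : 1 ≤ d) : headLang ∈ ACd d := by
  refine Set.mem_iUnion.2 ⟨1, headFamily, fun n => ?_, headFamily_decides⟩
  cases n with
  | zero =>
    refine ⟨Circuit.const_isOver_acBasis false, ?_, ?_⟩
    · change (Circuit.const (Fin 0) false).acDepth ≤ d
      rw [Circuit.acDepth_const]; exact hd
    · change (Circuit.const (Fin 0) false).size ≤ Polynomial.eval 0 1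
      simp [Circuit.size, Circuit.const]
  | succ k =>
    refine ⟨Circuit.isOver_input acBasis 0, ?_, ?_⟩
    · change (Circuit.input (0 : Fin (k + 1))).depthWith acWeight ≤ d
      simp [Circuit.depthWith, Circuit.input]
    · change (Circuit.input (0 : Fin (k + 1))).size ≤ Polynomial.eval ((k : ℕ) + 1) 1
      simp

/-- Hence `headLang ∈ AC0`. [folklore] -/
theorem headLang_mem_AC0 : headLang ∈ AC0 := by
  rw [AC0_eq_iUnion_ACd]
  exact Set.mem_iUnion.2 ⟨1, headLang_mem_ACd le_rfl⟩

/-- The K facts are about non-empty classes: `promiseLift (ACd d)` (`d ≥ 1`) and `promiseLift AC0`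
contain the problem lifted from `headLang`. [folklore] -/
theorem ofLanguage_headLang_mem_promiseLift_ACd {d : ℕ} (hd : 1 ≤ d) :
    PromiseProblem.ofLanguage headLang ∈ promiseLift (ACd d) :=
  ofLanguage_mem_promiseLift_iff.2 (headLang_mem_ACd hd)

/-- The T hypotheses are about non-empty classes too (`XorBottomModelsAE`). [folklore] -/
theorem ofLanguage_headLang_mem_promiseLift_ACdXORae' (e : ℕ) :
    PromiseProblem.ofLanguage headLang ∈ promiseLift (ACdXORae e (powSize 1.01)) :=
  ofLanguage_headLang_mem_promiseLift_ACdXORae e _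

/-- And the NO side of `MKtP[n^c, 2n^c]` is non-empty at every length `N` with `2 (log₂ N)^c < N`
(counting, `UniversalMachine.exists_mem_gapMKtP_no`). [folklore] -/
theorem exists_mem_gapMKtP_frontierA1_no (U : UniversalMachine) {c N : ℕ}
    (h : frontierA1No c N < N) :
    ∃ x : List Bool, x.length = N ∧ x ∈ (U.gapMKtP (frontierAYes c) (frontierA1No c)).no :=
  U.exists_mem_gapMKtP_no h

end Literature.Computability.MetaComplexity
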